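import Summits.AtomisticToContinuum.FouriersLaw.Theses.CoercivePulse
import Summits.AtomisticToContinuum.FouriersLaw.Theorems.CurrentTiltQuenchSymmetricSetup
import Summits.AtomisticToContinuum.FouriersLaw.Theorems.CageBudgetFeketeHeatVarianceCalculus
import Summits.AtomisticToContinuum.FouriersLaw.Theorems.CoercivePulseLinearCeilingAbelMeanCeiling
import Summits.AtomisticToContinuum.FouriersLaw.Theorems.CoercivePulseLinearSpreadBridgeAbelData
import HarnessLib

/-!
# On route CoercivePulse the conjunct `FouriersLaw` follows from the two bridge children (R) and CLB ALONE
(`--supports stmt-AtomisticToContinuum-15382`; closes nothing; lead of line `KaramataCollapse`, 2026-08-17, cycle 1)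

WHAT. `fouriersLaw_of_bridge : UniformAbelianRegularity → ConductanceLowerBound → FouriersLaw` — hypotheses = the route decls
`CoercivePulse.UniformAbelianRegularity` (item stmt-AtomisticToContinuum-13416) and `CoercivePulse.ConductanceLowerBound` (item
stmt-AtomisticToContinuum-11749), the two gen-1 children of the shared bridge `AbelThermodynamicLimit` (stmt-12596); conclusion = the
sub-problem Statement. So the honest open cone of the WHOLE route (six cruxes: `LinearSpread`, `LinearCeiling`, `AbelRegularity`,
`AbelThermodynamicLimit`, `PulseCalculus`, `SymmetricSetup`) is {stmt-13416, stmt-11749}: the three pulse cruxes and `PulseCalculus` are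
dispensable for the conjunct once (R) and CLB hold (the pulse cruxes themselves also follow: `linearSpread_of_bridge`,
`linearCeiling_of_uniformAbelianRegularity`, `stub_abelRegularityOfRegularity`).

HOW. `abelWitness_of_bridge`: at every `T > 0` the proved `SymmetricSetup` (`coercivePulse_symmetricSetup_proof`) gives a guarded pair
`(μ_T, D)`; the landed heat-variance calculus gives absolutely convergent correlations and Laplace integrability; (R) makes the Abel means
`Â(ν)` converge (`stub_abelRegularityOfRegularity`, Cauchy at `0⁺`; the `+∞` branch is excluded by the landed Abel-mean ceiling
`LinearCeiling.SpikeLemma.stub_abelMeanCeiling`), and (R) + CLB put a floor `a > 0` under them (`stub_abelFloorOfBridge`), so the limit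
`L ≥ a > 0` and `(μ_T, D, L/T²)` is an Abelian Green–Kubo witness. `fouriersLaw_of_bridge`: feed the witness to the bridge
(`AbelThermodynamicLimitGlueBy_holds hR hC`) and finish clauses (i)/(ii) exactly as the route's `closes` does (landed
`pinnedChain_exists_isSteadyState`, `nessUnique_proof`, `Corrector.openChainGreenKubo_holds`). No definitions, no named facts.
[cite: BonettoLebowitzReyBellet2000, §7 eq. (37)] [cite: KunduDharNarayan2009, p. 3]
-/

noncomputable section

namespace Summit.AtomisticToContinuum.FouriersLaw.Theorems.LinearSpread.KaramataCollapse

open MeasureTheory Filter Set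
open scoped Topology BigOperators
open Literature.MathematicalPhysics.KineticTheory.HeatConduction
open Summit.AtomisticToContinuum.FouriersLaw.Theses.CoercivePulse

/-- **An Abelian Green–Kubo witness at every temperature from (R) and CLB.** For `pinnedChain ω₂ lam β γ` (`ω₂, lam, β > 0`, any `γ`)
and `T > 0`: a DLR Gibbs state `μ_T`, a `μ_T`-preserving dynamics with absolutely convergent summed current correlations and `κ > 0`
with `T⁻²∫₀^∞e^{−νt}C_T(t)dt → κ` as `ν ↓ 0` (`μ_T` is moreover shift- and reversal-invariant). The pair is the proved `SymmetricSetup`;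
convergence of the Abel means is (R) (Cauchy at `0⁺`, ceiling from (R) to exclude `+∞`); positivity of the limit is the Abel floor from
(R) + CLB. [cite: BonettoLebowitzReyBellet2000, §7 eq. (37)] -/
theorem abelWitness_of_bridge (hR : UniformAbelianRegularity) (hC : ConductanceLowerBound) :
    ∀ ω₂ lam β γ : ℝ, 0 < ω₂ → 0 < lam → 0 < β → ∀ T : ℝ, 0 < T →
      ∃ (μT : Measure ChainConfig) (D : InfiniteChainDynamics (pinnedChain ω₂ lam β γ)) (κ : ℝ),
        (pinnedChain ω₂ lam β γ).IsChainGibbsMeasure T μT ∧ D.PreservesMeasure μT ∧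
        (∀ t : ℝ, D.HasAbsConvergentCorrelation μT t) ∧ 0 < κ ∧
        Tendsto (fun ν : ℝ => (T ^ 2)⁻¹ * MeasureTheory.integral (MeasureTheory.volume.restrict (Set.Ioi (0:ℝ)))
          (fun t : ℝ => Real.exp (-(ν * t)) * D.currentCorrelation μT t)) (𝓝[>] 0) (𝓝 κ) := by
  intro ω₂ lam β γ hω hl hβ T hT
  -- the guarded pair (proved `SymmetricSetup`)
  obtain ⟨μT, hG, hSI, hRefl, D, hP, hShift⟩ :=
    Summit.AtomisticToContinuum.FouriersLaw.Theorems.CurrentTiltQuench.coercivePulse_symmetricSetup_proof ω₂ lam β γ hω hl hβ T hT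
  -- the landed heat-variance calculus: absolute convergence and Laplace integrability
  obtain ⟨hAC, -, hVc⟩ :=
    Summit.AtomisticToContinuum.FouriersLaw.Theorems.HeatVarianceCalculus.CanonicalRigidity.heatVarianceCalculus_proof
      ω₂ lam β γ hω hl hβ T hT μT hG hSI hRefl D hP hShift
  obtain ⟨-, hLap⟩ := hVc _ rfl
  -- (R): the Abel means converge or tend to `+∞`; the ceiling from (R) excludes `+∞`
  have hreg := stub_abelRegularityOfRegularity hR ω₂ lam β γ hω hl hβ T hT μT hG hSI hRefl D hP hShift hAC
    (fun ν hν => (hLap ν hν).1)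
  obtain ⟨B, ν₁, hν₁, hB⟩ :=
    Summit.AtomisticToContinuum.FouriersLaw.Theorems.LinearCeiling.SpikeLemma.stub_abelMeanCeiling hR
      ω₂ lam β γ hω hl hβ T hT μT hG hSI hRefl D hP
  -- (R) + CLB: the floor
  obtain ⟨a, ν₀, ha, hν₀, hfloor⟩ := stub_abelFloorOfBridge hR hC ω₂ lam β γ hω hl hβ T hT μT hG hSI hRefl D hP
  set A : ℝ → ℝ := fun ν => ∫ t in Ioi (0:ℝ), Real.exp (-(ν * t)) * D.currentCorrelation μT t with hA
  have hevB : ∀ᶠ ν in 𝓝[>] (0:ℝ), A ν ≤ B := by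
    filter_upwards [Ioo_mem_nhdsGT hν₁] with ν hν using hB ν hν.1 hν.2
  have heva : ∀ᶠ ν in 𝓝[>] (0:ℝ), a ≤ A ν := by
    filter_upwards [Ioo_mem_nhdsGT hν₀] with ν hν using hfloor ν hν.1 hν.2
  obtain ⟨L, hL⟩ : ∃ L : ℝ, Tendsto A (𝓝[>] 0) (𝓝 L) := by
    rcases hreg with hconv | htop
    · exact hconv
    · exfalso
      obtain ⟨ν, h1, h2⟩ := (hevB.and (htop.eventually_ge_atTop (B + 1))).exists
      linarith
  have hLa : a ≤ L := ge_of_tendsto hL heva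
  refine ⟨μT, D, (T ^ 2)⁻¹ * L, hG, hP, hAC, mul_pos (by positivity) (lt_of_lt_of_le ha hLa), ?_⟩
  exact hL.const_mul _

/-- **`FouriersLaw` on route CoercivePulse from (R) and CLB alone** (`UniformAbelianRegularity → ConductanceLowerBound → FouriersLaw`):
the Abelian witness of `abelWitness_of_bridge` fed to the shared bridge `AbelThermodynamicLimit` (closed from its two children by the landed
glue `AbelThermodynamicLimitGlueBy_holds`), then clauses (i)–(ii) as in the route's `closes` (existence/uniqueness of the weak NESS, the
open-chain Green–Kubo identity for the finite-`N` response). The route's pulse cruxes and `PulseCalculus` are not used.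
[cite: BonettoLebowitzReyBellet2000, §7 eq. (37)] [cite: KunduDharNarayan2009, p. 3] -/
theorem fouriersLaw_of_bridge : Summit.AtomisticToContinuum.FouriersLaw.Theses.CoercivePulse.UniformAbelianRegularity → Summit.AtomisticToContinuum.FouriersLaw.Theses.CoercivePulse.ConductanceLowerBound → _root_.FouriersLaw := by
  intro hR hC
  have hTL : AbelThermodynamicLimit := AbelThermodynamicLimitGlueBy_holds hR hC
  intro ω₂ lam β γ hω hl hβ hγ
  have hUq := _root_.Summit.AtomisticToContinuum.FouriersLaw.Theorems.nessUnique_proof ω₂ lam β γ hω hl hβ hγ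
  refine ⟨fun N T_L T_R h1 h2 => ?_, ?_⟩
  · obtain ⟨μ, hμ⟩ := Literature.MathematicalPhysics.KineticTheory.HeatConduction.pinnedChain_exists_isSteadyState
      hω hl hβ hγ N h1 h2
    exact ⟨μ, hμ, fun ν hν => hUq N T_L T_R h1 h2 ν μ hν hμ⟩
  -- clause (ii): the Abelian Green–Kubo witness at every temperature, fed to the bridge
  have hW := fun T (hT : 0 < T) => hTL ω₂ lam β γ hω hl hβ hγ hUq T hT
    (abelWitness_of_bridge hR hC ω₂ lam β γ hω hl hβ T hT)
  classical
  refine ⟨fun T => if hT : 0 < T then (hW T hT).choose_spec.choose_spec.choose else 1, fun T hT => ?_, fun μ hμ T hT => ?_⟩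
  · simp only [dif_pos hT]; exact (hW T hT).choose_spec.choose_spec.choose_spec.1.2.2.2.1
  · -- finite-`N` response: no bonds for `N ≤ 1`; the open-chain Green–Kubo identity (landed) for `N ≥ 2`
    have hD : ∀ N : ℕ, ∃ Dc : ℝ, Tendsto (fun δ : ℝ =>
        (Literature.MathematicalPhysics.KineticTheory.HeatConduction.pinnedChain ω₂ lam β γ).totalCurrent
          (μ N (T + δ / 2) (T - δ / 2)) / δ) (𝓝[≠] 0) (𝓝 Dc) := by
      intro N
      rcases lt_or_ge N 2 with hN | hN
      · refine ⟨0, ?_⟩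
        have hj : ∀ (i : Fin N) (x : Literature.MathematicalPhysics.KineticTheory.HeatConduction.PhaseSpace N),
            (Literature.MathematicalPhysics.KineticTheory.HeatConduction.pinnedChain ω₂ lam β γ).bondCurrent N i x = 0 :=
          fun i x => by
            unfold Literature.MathematicalPhysics.KineticTheory.HeatConduction.OscillatorChain.bondCurrent
            refine Finset.sum_eq_zero fun j _ => ?_
            have hji : ¬ (j.val = i.val + 1) := by have := j.isLt; omega
            rw [if_neg hji]
        have e : (fun δ : ℝ => (Literature.MathematicalPhysics.KineticTheory.HeatConduction.pinnedChain ω₂ lam β γ).totalCurrent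
            (μ N (T + δ / 2) (T - δ / 2)) / δ) = fun _ => 0 := funext fun δ => by
          have : (Literature.MathematicalPhysics.KineticTheory.HeatConduction.pinnedChain ω₂ lam β γ).totalCurrent
              (μ N (T + δ / 2) (T - δ / 2)) = 0 := by
            show ∑ i : Fin N, ∫ x, (Literature.MathematicalPhysics.KineticTheory.HeatConduction.pinnedChain ω₂ lam β γ).bondCurrent
              N i x ∂(μ N (T + δ / 2) (T - δ / 2)) = 0
            exact Finset.sum_eq_zero fun i _ => by simp only [hj, integral_zero]
          rw [this, zero_div]
        rw [e]; exact tendsto_const_nhds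
      · obtain ⟨-, h2⟩ := _root_.Summit.AtomisticToContinuum.FouriersLaw.Theorems.OddSectorIrreversibility.Corrector.openChainGreenKubo_holds
          ω₂ lam β γ hω hl hβ hγ hUq μ hμ T hT N hN
        exact ⟨_, h2⟩
    refine ⟨fun N => (hD N).choose, fun N => (hD N).choose_spec, ?_⟩
    simp only [dif_pos hT]
    exact (hW T hT).choose_spec.choose_spec.choose_spec.2 μ hμ _ fun N => (hD N).choose_spec

end Summit.AtomisticToContinuum.FouriersLaw.Theorems.LinearSpread.KaramataCollapse

end
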